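import Literature.IUT.HodgeTheaters.ConventionsCatIsomorphismKinds
import Literature.AlgebraicGeometry.Frobenioids.ModelFrobenioidSelfEquivalenceRigidity
import Literature.AlgebraicGeometry.Frobenioids.Cor411ModelFrobenioid
import Literature.IUT.HodgeTheaters.GlobalFrobenioidsBaseOnEquivalences
import HarnessLib

/-!
# [IUTchI] Cor 5.3 (iv)/(ii), injectivity of `Aut(𝒞) → Aut(𝒟)` at a MODEL FROBENIOID from «α over the identity
# induces the identity on the rational-function and divisor monoids» (proof-only knit: §0 `descend` × [FrdI] S2)

S. Mochizuki, *Inter-universal Teichmüller theory I*, kurims manuscript (May 2020), §5 Corollary 5.3 (iv) p. 144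
l. 24–30, proof p. 144 l. 41 – p. 145 l. 9: «it remains to verify injectivity. To this end, let
`α ∈ Ker(Aut(ℱ̲_v) → Aut(𝒟_v))`. For simplicity, we suppose [without loss of generality] that `α` lies over the identity
self-equivalence of `𝒟_v`. Then I claim that to show that `α` is [isomorphic to] the identity self-equivalence of
`ℱ̲_v`, it suffices to verify that `α` induces […] the identity on the rational function and divisor monoids of `ℱ̲_v`»
([IUTchI] Cor 5.3 (iv) p.144) [claim: Mochizuki2012, status: disputed] (D-0012 claim key; nothing of the series is
asserted; no side taken on [IUTchIII] Cor. 3.12).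

PROOF-ONLY knit (theorems only) of two landed files, for cone node `IUTchI:Cor5.3(iv)` (and the model case of
`IUTchI:Cor5.3(ii)` at a model Frobenioid), plan/L5 `SUBDAG-IUTchI-Cor53.md` rows C53iv/S2 + §0 T1/T2:
* §0 currency (abc-iut-L5-t4 `ConventionsCatIsomorphismGroup` p491065 / `…Kinds` p492186): the natural map
  `CatIsomorphism.descend he hu : Isom(𝒞, 𝒞) → Isom(𝒟, 𝒟)` under the [FrdI] Cor 4.11 binders `HasUnder`/`UnderUnique`,
  and `descend_injective_of_kernel_trivial` (print's «wlog over the identity» reduction, p.144 l.43–45);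
* [FrdI] S2 (abc-iut-L1-t7 `ModelFrobenioidSelfEquivalenceRigidity` p491743):
  `ModelFrobenioid.selfEquivalence_iso_id_of_over_base` — a self-equivalence of the model Frobenioid
  `ModelFrobenioid Φ B DivB` lying over `𝟭` (η), preserving `deg_Fr`, inducing the identity on `Φ` and `B` through η,
  is `≅ 𝟭` (no hypothesis on `Φ`, `B`, `Div_B`, `D`).
* [FrdI] Cor 4.11 at THE model Frobenioid (abc-iut-L1-t14 `Cor411ModelFrobenioid` p491530):
  `exists_oneUniqueSquare_base_model` (the 1-unique `Ψ^Base`) and `preservesDegFr_model`, over slim bases of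
  FSMFF-type with perf-factorial, non-dilating, non-zero `Φ` — which DISCHARGE the §0 binders `he`/`hu` (through
  abc-iut-L6-t7's generic `CatIsomorphism.hasUnder_of_forall_oneUniqueSquare` / `underUnique_of_forall_oneUniqueSquare`,
  `GlobalFrobenioidsBaseOnEquivalences` p492904, consumed BY NAME) and the `deg_Fr` clause of the law
  (`hasUnder_baseFunctor_model`, `underUnique_baseFunctor_model`, §B below).
RESULT: for ANY model Frobenioid `𝒞 = ModelFrobenioid Φ B DivB` over `𝒟 = D` (via `baseFunctor`):
`Cor53.descend_injective_of_monoidRigid` — the natural map `Aut(𝒞) → Aut(𝒟)` (resp. `Isom`) is INJECTIVE as soon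
as (displayed LAW, = print's steps S3–S5 at the tempered Frobenioid / the Kummer pair-rigidity at `𝒞_v`) every
self-equivalence of `𝒞` lying over the identity of `𝒟` preserves Frobenius degrees and induces the identity on the
divisor monoid `Φ` and on the rational-function monoid `B` through SOME identification `η` of its base part with the
identity; `…_bijective_of_monoidRigid_of_lifts` adds the surjectivity half from a lifting hypothesis (print:
«surjectivity follows immediately from the construction of `ℱ̲_v`», [AbsTopIII] Thm 1.9 — FACT-policy, BY NAME).
Binder census of the headline: DATA {Φ, B, DivB over D}; BINDERS he (Cor 4.11 (i)), hu (Cor 4.11 (iv)); LAW hmon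
(S3∧S4∧S5 content incl. deg_Fr preservation, Cor 4.11 (iii)); for bijectivity + hlift.  Typed ≠ proved for hmon/hlift.
-/

namespace Literature.IUT.HodgeTheaters

open CategoryTheory Opposite Literature.AlgebraicGeometry.Frobenioids

universe w v u

namespace Cor53

variable {D : Type u} [Category.{v} D] {Φ B : Dᵒᵖ ⥤ CommMonCat.{w}} {DivB : B ⟶ monoidGp Φ}

/-- **[IUTchI] Cor 5.3 (iv), injectivity, at a model Frobenioid — from monoid rigidity over the identity.**
For `𝒞 = ModelFrobenioid Φ B DivB` over its base `D` (`baseFunctor`), the natural map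
`Isom(𝒞, 𝒞) → Isom(D, D)` of §0 (`CatIsomorphism.descend`, under the [FrdI] Cor 4.11 binders `he`, `hu`) is injective
provided (LAW `hmon`, print p.145 l.1–2 «`α` induces the identity on the rational function and divisor monoids»,
established in print by steps S3–S5) every self-equivalence `Ψ` of `𝒞` whose base part is identified with the
identity admits an identification `η` through which `Ψ` preserves `deg_Fr` and induces the identity on `Φ` and on
`B`.  Proof: §0 kernel-form reduction + abc-iut-L1-t7's [FrdI] rigidity `selfEquivalence_iso_id_of_over_base`.
([IUTchI] Cor 5.3 (iv) p.144) [claim: Mochizuki2012, status: disputed] -/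
theorem descend_injective_of_monoidRigid
    (he : CatIsomorphism.HasUnder (ModelFrobenioid.baseFunctor Φ B DivB) (ModelFrobenioid.baseFunctor Φ B DivB))
    (hu : CatIsomorphism.UnderUnique (ModelFrobenioid.baseFunctor Φ B DivB) (ModelFrobenioid.baseFunctor Φ B DivB))
    (hmon : ∀ Ψ : ModelFrobenioid Φ B DivB ≌ ModelFrobenioid Φ B DivB,
      Nonempty (Ψ.functor ⋙ ModelFrobenioid.baseFunctor Φ B DivB ≅ ModelFrobenioid.baseFunctor Φ B DivB) →
      ∃ η : Ψ.functor ⋙ ModelFrobenioid.baseFunctor Φ B DivB ≅ ModelFrobenioid.baseFunctor Φ B DivB,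
        (∀ ⦃X Y : ModelFrobenioid Φ B DivB⦄ (φ : X ⟶ Y),
            ModelFrobenioid.degFr (Ψ.functor.map φ) = ModelFrobenioid.degFr φ) ∧
        (∀ ⦃X Y : ModelFrobenioid Φ B DivB⦄ (φ : X ⟶ Y),
            ModelFrobenioid.div (Ψ.functor.map φ) =
              pull Φ (η.hom.app X : (Ψ.functor.obj X).base ⟶ X.base) (ModelFrobenioid.div φ)) ∧
        (∀ ⦃X Y : ModelFrobenioid Φ B DivB⦄ (φ : X ⟶ Y),
            ModelFrobenioid.unit (Ψ.functor.map φ) =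
              pull B (η.hom.app X : (Ψ.functor.obj X).base ⟶ X.base) (ModelFrobenioid.unit φ))) :
    Function.Injective (CatIsomorphism.descend he hu) := by
  refine CatIsomorphism.descend_injective_of_kernel_trivial he hu fun Ψ hΨ => ?_
  obtain ⟨h⟩ := hΨ
  obtain ⟨η, hdeg, hdiv, hunit⟩ := hmon Ψ ⟨h ≪≫ (ModelFrobenioid.baseFunctor Φ B DivB).rightUnitor⟩
  exact ModelFrobenioid.selfEquivalence_iso_id_of_over_base Ψ η hdeg hdiv hunit

/-- The same in `Aut(−)`-homomorphism form: «the natural homomorphism `Aut(ℱ̲_v) → Aut(𝒟_v)`» (`descendHom`) is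
injective under the monoid-rigidity law. ([IUTchI] Cor 5.3 (iv) p.144) [claim: Mochizuki2012, status: disputed] -/
theorem descendHom_injective_of_monoidRigid
    (he : CatIsomorphism.HasUnder (ModelFrobenioid.baseFunctor Φ B DivB) (ModelFrobenioid.baseFunctor Φ B DivB))
    (hu : CatIsomorphism.UnderUnique (ModelFrobenioid.baseFunctor Φ B DivB) (ModelFrobenioid.baseFunctor Φ B DivB))
    (hmon : ∀ Ψ : ModelFrobenioid Φ B DivB ≌ ModelFrobenioid Φ B DivB,
      Nonempty (Ψ.functor ⋙ ModelFrobenioid.baseFunctor Φ B DivB ≅ ModelFrobenioid.baseFunctor Φ B DivB) →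
      ∃ η : Ψ.functor ⋙ ModelFrobenioid.baseFunctor Φ B DivB ≅ ModelFrobenioid.baseFunctor Φ B DivB,
        (∀ ⦃X Y : ModelFrobenioid Φ B DivB⦄ (φ : X ⟶ Y),
            ModelFrobenioid.degFr (Ψ.functor.map φ) = ModelFrobenioid.degFr φ) ∧
        (∀ ⦃X Y : ModelFrobenioid Φ B DivB⦄ (φ : X ⟶ Y),
            ModelFrobenioid.div (Ψ.functor.map φ) =
              pull Φ (η.hom.app X : (Ψ.functor.obj X).base ⟶ X.base) (ModelFrobenioid.div φ)) ∧
        (∀ ⦃X Y : ModelFrobenioid Φ B DivB⦄ (φ : X ⟶ Y),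
            ModelFrobenioid.unit (Ψ.functor.map φ) =
              pull B (η.hom.app X : (Ψ.functor.obj X).base ⟶ X.base) (ModelFrobenioid.unit φ))) :
    Function.Injective (CatIsomorphism.descendHom he hu) :=
  descend_injective_of_monoidRigid he hu hmon

/-- **Cor 5.3 (iv) at a model Frobenioid, both halves**: `Aut(𝒞) → Aut(𝒟)` is BIJECTIVE
(`CatIsomorphism.DescendBijective`) from the monoid-rigidity law (injectivity) and a lifting hypothesis `hlift`
(surjectivity; print p.144 l.41–43: «since automorphisms of `𝒟_v = ℬ^temp(X̲̲_v)⁰` necessarily arise from automorphisms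
of the scheme `X̲̲_v` [[AbsTopIII] Thm 1.9, Rmk 1.9.1], surjectivity follows immediately from the construction of
`ℱ̲_v`» — consumed BY NAME). ([IUTchI] Cor 5.3 (iv) p.144) [claim: Mochizuki2012, status: disputed] -/
theorem descendBijective_of_monoidRigid_of_lifts
    (he : CatIsomorphism.HasUnder (ModelFrobenioid.baseFunctor Φ B DivB) (ModelFrobenioid.baseFunctor Φ B DivB))
    (hu : CatIsomorphism.UnderUnique (ModelFrobenioid.baseFunctor Φ B DivB) (ModelFrobenioid.baseFunctor Φ B DivB))
    (hmon : ∀ Ψ : ModelFrobenioid Φ B DivB ≌ ModelFrobenioid Φ B DivB,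
      Nonempty (Ψ.functor ⋙ ModelFrobenioid.baseFunctor Φ B DivB ≅ ModelFrobenioid.baseFunctor Φ B DivB) →
      ∃ η : Ψ.functor ⋙ ModelFrobenioid.baseFunctor Φ B DivB ≅ ModelFrobenioid.baseFunctor Φ B DivB,
        (∀ ⦃X Y : ModelFrobenioid Φ B DivB⦄ (φ : X ⟶ Y),
            ModelFrobenioid.degFr (Ψ.functor.map φ) = ModelFrobenioid.degFr φ) ∧
        (∀ ⦃X Y : ModelFrobenioid Φ B DivB⦄ (φ : X ⟶ Y),
            ModelFrobenioid.div (Ψ.functor.map φ) =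
              pull Φ (η.hom.app X : (Ψ.functor.obj X).base ⟶ X.base) (ModelFrobenioid.div φ)) ∧
        (∀ ⦃X Y : ModelFrobenioid Φ B DivB⦄ (φ : X ⟶ Y),
            ModelFrobenioid.unit (Ψ.functor.map φ) =
              pull B (η.hom.app X : (Ψ.functor.obj X).base ⟶ X.base) (ModelFrobenioid.unit φ)))
    (hlift : ∀ Θ : D ≌ D, ∃ Ψ : ModelFrobenioid Φ B DivB ≌ ModelFrobenioid Φ B DivB,
      Nonempty (CatIsomorphism.LiesUnder (ModelFrobenioid.baseFunctor Φ B DivB) (ModelFrobenioid.baseFunctor Φ B DivB) Ψ Θ)) :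
    CatIsomorphism.DescendBijective (ModelFrobenioid.baseFunctor Φ B DivB) (ModelFrobenioid.baseFunctor Φ B DivB) he hu :=
  ⟨descend_injective_of_monoidRigid he hu hmon, CatIsomorphism.descend_surjective_of_lifts he hu hlift⟩

/-- …and hence, at the one-object kind `SingleObj (Aut(𝒞))` with base functor `kindFunctor he hu`, abc-iut-L5-t4's
MODEL CASE of `FKit.isomFtoDBijective_of_model` (p409092) holds at this slot (T2 `mapIso_kindFunctor_bijective_iff`).
([IUTchI] Cor 5.3 (ii) p.144) [claim: Mochizuki2012, status: disputed] -/
theorem mapIso_kindFunctor_bijective_of_monoidRigid_of_lifts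
    (he : CatIsomorphism.HasUnder (ModelFrobenioid.baseFunctor Φ B DivB) (ModelFrobenioid.baseFunctor Φ B DivB))
    (hu : CatIsomorphism.UnderUnique (ModelFrobenioid.baseFunctor Φ B DivB) (ModelFrobenioid.baseFunctor Φ B DivB))
    (hmon : ∀ Ψ : ModelFrobenioid Φ B DivB ≌ ModelFrobenioid Φ B DivB,
      Nonempty (Ψ.functor ⋙ ModelFrobenioid.baseFunctor Φ B DivB ≅ ModelFrobenioid.baseFunctor Φ B DivB) →
      ∃ η : Ψ.functor ⋙ ModelFrobenioid.baseFunctor Φ B DivB ≅ ModelFrobenioid.baseFunctor Φ B DivB,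
        (∀ ⦃X Y : ModelFrobenioid Φ B DivB⦄ (φ : X ⟶ Y),
            ModelFrobenioid.degFr (Ψ.functor.map φ) = ModelFrobenioid.degFr φ) ∧
        (∀ ⦃X Y : ModelFrobenioid Φ B DivB⦄ (φ : X ⟶ Y),
            ModelFrobenioid.div (Ψ.functor.map φ) =
              pull Φ (η.hom.app X : (Ψ.functor.obj X).base ⟶ X.base) (ModelFrobenioid.div φ)) ∧
        (∀ ⦃X Y : ModelFrobenioid Φ B DivB⦄ (φ : X ⟶ Y),
            ModelFrobenioid.unit (Ψ.functor.map φ) =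
              pull B (η.hom.app X : (Ψ.functor.obj X).base ⟶ X.base) (ModelFrobenioid.unit φ)))
    (hlift : ∀ Θ : D ≌ D, ∃ Ψ : ModelFrobenioid Φ B DivB ≌ ModelFrobenioid Φ B DivB,
      Nonempty (CatIsomorphism.LiesUnder (ModelFrobenioid.baseFunctor Φ B DivB) (ModelFrobenioid.baseFunctor Φ B DivB) Ψ Θ)) :
    Function.Bijective
      (fun α : SingleObj.star (CatAut (ModelFrobenioid Φ B DivB)) ≅ SingleObj.star (CatAut (ModelFrobenioid Φ B DivB)) =>
        (show SingleObj.star (CatAut D) ≅ SingleObj.star (CatAut D) from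
          (CatIsomorphism.kindFunctor he hu).mapIso α)) :=
  (CatIsomorphism.mapIso_kindFunctor_bijective_iff he hu).2 (descendBijective_of_monoidRigid_of_lifts he hu hmon hlift)

/-! ### At THE model Frobenioid over a slim base of FSMFF-type: binders discharged from L1's Cor 4.11 (ii)/(iv) -/

section Model

open PreFrobenioid PreFrobenioidData

/-- The §0 existence binder `HasUnder` for the model Frobenioid `ModelFrobenioid Φ B DivB` over its base, from
[FrdI] Cor 4.11 (ii) at the model (abc-iut-L1-t14 `exists_oneUniqueSquare_base_model`), under print's standing
hypotheses BY NAME: Thm 5.2 `Hypotheses`, `Φ` perf-factorial, non-dilating, non-zero; `D` slim of FSMFF-type.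
([IUTchI] Cor 5.3 p.144) [claim: Mochizuki2012, status: disputed] -/
theorem hasUnder_baseFunctor_model (h : ModelFrobenioid.Hypotheses Φ B)
    (hpf : Objectwise (fun M _ => IsPerfFactorial M) Φ) (hsl : IsSlim D) (hfs : IsOfFSMFFType D)
    (hnd : IsNonDilatingOn Φ) (hz : ¬ ModelFrobenioid.IsZeroMonoid Φ) :
    CatIsomorphism.HasUnder (ModelFrobenioid.baseFunctor Φ B DivB) (ModelFrobenioid.baseFunctor Φ B DivB) :=
  CatIsomorphism.hasUnder_of_forall_oneUniqueSquare fun Ψ => by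
    obtain ⟨F, hF, -⟩ := ModelFrobenioid.exists_oneUniqueSquare_base_model (DivB₁ := DivB) (DivB₂ := DivB)
      h h hpf hpf hsl hsl hfs hfs hnd hnd hz hz Ψ
    exact ⟨F, hF⟩

/-- The §0 uniqueness binder `UnderUnique` for the model Frobenioid over its base, same source and hypotheses.
([IUTchI] Cor 5.3 p.144) [claim: Mochizuki2012, status: disputed] -/
theorem underUnique_baseFunctor_model (h : ModelFrobenioid.Hypotheses Φ B)
    (hpf : Objectwise (fun M _ => IsPerfFactorial M) Φ) (hsl : IsSlim D) (hfs : IsOfFSMFFType D)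
    (hnd : IsNonDilatingOn Φ) (hz : ¬ ModelFrobenioid.IsZeroMonoid Φ) :
    CatIsomorphism.UnderUnique (ModelFrobenioid.baseFunctor Φ B DivB) (ModelFrobenioid.baseFunctor Φ B DivB) :=
  CatIsomorphism.underUnique_of_forall_oneUniqueSquare fun Ψ => by
    obtain ⟨F, hF, -⟩ := ModelFrobenioid.exists_oneUniqueSquare_base_model (DivB₁ := DivB) (DivB₂ := DivB)
      h h hpf hpf hsl hsl hfs hfs hnd hnd hz hz Ψ
    exact ⟨F, hF⟩

/-- **[IUTchI] Cor 5.3 (iv), injectivity, at THE model Frobenioid over a slim base of FSMFF-type — binders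
DISCHARGED, one LAW displayed.**  Under print's standing hypotheses on `(Φ, B, Div_B; D)` BY NAME (Thm 5.2
`Hypotheses`; `Φ` perf-factorial, non-dilating, non-zero; `D` slim, FSMFF), the natural map
`Aut(𝒞) → Aut(𝒟)` (`descend`, with `he`/`hu` from [FrdI] Cor 4.11 (ii) and `deg_Fr`-preservation from Cor 4.11 (iv)
`preservesDegFr_model`) is INJECTIVE modulo the single LAW «every self-equivalence over the identity of the base
induces the identity on `Φ` and on `B` through some base identification» (print p.145 l.1–2; steps S3–S5).
([IUTchI] Cor 5.3 (iv) p.144) [claim: Mochizuki2012, status: disputed] -/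
theorem descend_injective_model_of_monoidRigid (h : ModelFrobenioid.Hypotheses Φ B)
    (hpf : Objectwise (fun M _ => IsPerfFactorial M) Φ) (hsl : IsSlim D) (hfs : IsOfFSMFFType D)
    (hnd : IsNonDilatingOn Φ) (hz : ¬ ModelFrobenioid.IsZeroMonoid Φ)
    (hmon : ∀ Ψ : ModelFrobenioid Φ B DivB ≌ ModelFrobenioid Φ B DivB,
      Nonempty (Ψ.functor ⋙ ModelFrobenioid.baseFunctor Φ B DivB ≅ ModelFrobenioid.baseFunctor Φ B DivB) →
      ∃ η : Ψ.functor ⋙ ModelFrobenioid.baseFunctor Φ B DivB ≅ ModelFrobenioid.baseFunctor Φ B DivB,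
        (∀ ⦃X Y : ModelFrobenioid Φ B DivB⦄ (φ : X ⟶ Y),
            ModelFrobenioid.div (Ψ.functor.map φ) =
              pull Φ (η.hom.app X : (Ψ.functor.obj X).base ⟶ X.base) (ModelFrobenioid.div φ)) ∧
        (∀ ⦃X Y : ModelFrobenioid Φ B DivB⦄ (φ : X ⟶ Y),
            ModelFrobenioid.unit (Ψ.functor.map φ) =
              pull B (η.hom.app X : (Ψ.functor.obj X).base ⟶ X.base) (ModelFrobenioid.unit φ))) :
    Function.Injective (CatIsomorphism.descend (hasUnder_baseFunctor_model (DivB := DivB) h hpf hsl hfs hnd hz)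
      (underUnique_baseFunctor_model (DivB := DivB) h hpf hsl hfs hnd hz)) := by
  refine descend_injective_of_monoidRigid _ _ fun Ψ hΨ => ?_
  obtain ⟨η, hdiv, hunit⟩ := hmon Ψ hΨ
  have hdeg := ModelFrobenioid.preservesDegFr_model (DivB₁ := DivB) (DivB₂ := DivB)
    h h hsl hsl hfs hfs hnd hnd hz hz Ψ
  exact ⟨η, fun X Y φ => hdeg φ, hdiv, hunit⟩

end Model

end Cor53

end Literature.IUT.HodgeTheaters
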